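import Summits.BirchSwinnertonDyer.BirchSwinnertonDyer.Theses.EisensteinPrimes
import Summits.BirchSwinnertonDyer.BirchSwinnertonDyer.Theorems.Rank1ResidualX1Isogeny
import Summits.BirchSwinnertonDyer.BirchSwinnertonDyer.Theorems.EisensteinPrimesMazurMCOnX1RankZeroLocate
import Summits.BirchSwinnertonDyer.Rank1Residual.X1.TamagawaSqueeze
import Literature.Barriers.BirchSwinnertonDyer.EisensteinMuConjecture
import Literature.NumberTheory.EllipticCurves.SupersingularIrreducibleProofs
import Literature.NumberTheory.EllipticCurves.AnalyticRankModularityProofs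
import HarnessLib

/-!
# Crux `MazurMCOnX1RankZero` (stmt-BirchSwinnertonDyer-19035) — the line `mudescent` (Λ-adic isogeny
# μ-descent, rank-0 X1 twin) AS A THEOREM OF THE TREE: the crux BY NAME from the route's published
# inputs, Kato–Wuthrich divisibility, and the two open stubs stated verbatim as hypotheses (the door)

Cell `bsd-eis` (FULL-BSD rank-≤1 programme D-0033, HOME `run/shared/lean/pub/bsd-eis/`), seat
`bsd-eis-ky` gen 8 (prover). Route `route-BirchSwinnertonDyer-EisensteinPrimes` (rung K5), crux 5 =
row A3 of the ladder (corner X1: `p > 2` good ANOMALOUS with `E[p]` reducible, analytic rank `0`; on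
this leaf `ClassX1` forces type A = `¬ GVPar`; 149 residue classes N < 5·10⁵). The `mudescent`
skeleton on this item (ky g7, 2026-08-26, sha16 d113fc0a38784230; stubs `stub_publishedInputs` [FACT],
`stub_wuthrich16` [FACT], `stub_analyticMuZero_offLocus`, `stub_lambdaCount_offLocus`; `stub_locate`
LANDED p443510) was SUPERSEDED as skeleton of record on 2026-08-27 by the certificate-currency line
`deepwitness` of cell bsd-wall (director-bsd ruling (β) 07:05:46Z). This file records the superseded
line's logical content in the tree BY NAME, so that its reduction «crux 5 ⟸ PUB + Greenberg's
μ-conjecture at the étale end + the type-A λ-count at the étale end» stays citable and attackable: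
`ledger crux write` is refused for this unit, so the skeleton itself exists only as item evidence.

WHAT IS PROVED (theorems only; `--supports` the item as a helper, closes nothing):
* `mazurMainConjecture_of_member_rankZero` — PER PAIR: at a rank-0 X1 pair `(W, p)`, ANY isogenous
  member `W₀` with `X1.MuPart.AnalyticMuLE W₀ p 0` (`μ_an(W₀) = 0`), `X1.ParitySqueeze.AnalyticLambdaEq
  W₀ p n`, `X1.TamagawaSqueeze.AlgebraicLambdaGE W₀ p k`, `n ≤ k` gives Mazur's main conjecture at
  `(W, p)` (route T at `W₀`: `X1.MuPart.muPartAt_of_analyticMuLE_zero` +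
  `X1.TamagawaSqueeze.mazurMainConjecture_of_algebraicLambdaGE`; ascent at rank 0:
  `Rank1ResidualX1Isogeny.mazurMainConjecture_iff_of_isIsogenous_of_analyticRank_eq_zero`). Published
  inputs as six named hypotheses. No locus hypothesis is needed for the implication.
* `mazurMCOnX1RankZero_of_analyticMuZero_offLocus_of_lambdaCount_offLocus` — THE DOOR: the crux
  `Summit.…Theses.EisensteinPrimes.MazurMCOnX1RankZero` (verbatim) from `EisensteinPrimes.PublishedInputs`
  (support item -19037), `Wuthrich2014.charIdeal_dvd_padicLFunction` (cite-only PUB fact, the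
  skeleton's `stub_wuthrich16`) and the two open stubs AS HYPOTHESES, byte-for-byte as registered
  (`hμ` = `stub_analyticMuZero_offLocus`, `hlc` = `stub_lambdaCount_offLocus`). Composition = the
  registered `MazurMCOnX1RankZero_of`: DESCEND (`stub_locate`, p443510) → leaf transport
  (`ClassX1.of_isIsogenous`, Faltings) → route T at `W₀` → ASCEND.
* `mu_eq_zero_offLocus_of_analyticMuZero_offLocus` / `exists_isIsogenous_mu_eq_zero_of_analyticMuZero_offLocus`
  — BY-PRODUCT: granted Wuthrich Thm. 16 and modularity, stub 4 ALONE gives Greenberg's Conj. 1.11 on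
  the rank-0 X1 leaf in located form (`μ = 0` for every cyclotomic dual datum at every pair off the
  `μ`-barrier locus; `X1.MuPart.mu_eq_zero_of_analyticMuLE_zero`) and in Greenberg's own «some
  isogenous curve has `μ = 0`» form (via `stub_locate`).

HONEST FRAMING: nothing here proves a main conjecture or books a cell; BSD is proved for no curve;
`hμ`/`hlc` are OPEN statements carried as plain hypotheses (Greenberg–Vatsal Thm. (1.3) is type B;
CGS 2025 Thm. A excludes `φ|_{G_p} ∈ {1, ω}`; Keller–Yin Thm. 3.0.10 is a PREPRINT claim); per pair
they are the cell's two-engine certificates, consumed through `mazurMainConjecture_of_member_rankZero`.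

References: [GreenbergLNM1716] Conj. 1.11 (p. 58), Prop. 5.7, Cor. 5.6 (p. 136), Thm. 4.1;
[GreenbergVatsal2000] (1)–(2), §3 Rem. after Cor. (3.8); [Wuthrich2014] Thm. 16 (p. 397);
[PerrinRiou1989Isogenie] Théorème (p. 349); HOME/ky-g7/Lines-mudescent.md; HOME/ky-g8/.
-/

set_option linter.dupNamespace false
set_option autoImplicit false

namespace Summit.BirchSwinnertonDyer.BirchSwinnertonDyer.Theorems.EisensteinPrimesMazurMCOnX1RankZeroMudescent

open WeierstrassCurve
open Literature.NumberTheory.EllipticCurves Literature.NumberTheory.EllipticCurves.Rank1Residual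
  Literature.NumberTheory.EllipticCurves.ModularForms
open Literature.Barriers.BirchSwinnertonDyer (HasRamifiedOddLineAt)
open Summit.BirchSwinnertonDyer.Rank1Residual
open Summit.BirchSwinnertonDyer.BirchSwinnertonDyer.Theses
open Summit.BirchSwinnertonDyer.BirchSwinnertonDyer.Theorems
open Summit.BirchSwinnertonDyer.BirchSwinnertonDyer.Theorems.Rank1ResidualX1Defs

/-! ## §1. The per-pair composition: route T at an isogenous member, then ascent at rank 0 -/

/-- **Mazur's main conjecture at a rank-0 X1 pair from the `(μ, λ)` data of ANY isogenous member**
(the per-pair form of the line `mudescent`; the member is typically the étale end `W₀` of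
`stub_locate`). Published inputs BY NAME: Wuthrich 2014 Thm. 16 at a good ordinary reducible prime
(`hW16`), Greenberg 1999 Thm. 4.1 (`hGr`), modularity (`hmod hnf`), Gross–Zagier–Kolyvagin (`hGZK`),
Cassels' isogeny invariance of the BSD quotient (`hCassels`). Data: `ClassX1 W p`, `r_an(W) = 0`,
`IsIsogenous W W₀`, `X1.MuPart.AnalyticMuLE W₀ p 0`, `X1.ParitySqueeze.AnalyticLambdaEq W₀ p n`,
`X1.TamagawaSqueeze.AlgebraicLambdaGE W₀ p k`, `n ≤ k`. Proof: the leaf and the rank transport to `W₀`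
(`ClassX1.of_isIsogenous`, `analyticRank_eq_of_isIsogenous'`); a good Eisenstein `p > 2` is ordinary
(`goodOrd_of_red_of_good`); the μ-part at `W₀` (`X1.MuPart.muPartAt_of_analyticMuLE_zero`) and route T
(`X1.TamagawaSqueeze.mazurMainConjecture_of_algebraicLambdaGE`); ascent along `W ∼ W₀`
(`Rank1ResidualX1Isogeny.mazurMainConjecture_iff_of_isIsogenous_of_analyticRank_eq_zero`).
[cite: Wuthrich2014, Thm. 16 (p. 397)] [cite: GreenbergLNM1716, Cor. 5.6 (proof, p. 136), Thm. 4.1]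
[cite: PerrinRiou1989Isogenie, Théorème (p. 349)] -/
theorem mazurMainConjecture_of_member_rankZero
    (hW16 : Wuthrich2014.charIdeal_dvd_padicLFunction) (hGr : greenberg_charValue_rankZero)
    (hmod : nonempty_modularParametrizationData) (hnf : exists_isNewformOf)
    (hGZK : rank_eq_analyticRank_of_analyticRank_le_one) (hCassels : bsdRHS_eq_of_isIsogenous)
    (W : WeierstrassCurve ℚ) [W.IsElliptic] [W.IsGloballyMinimal] (p : ℕ) [Fact p.Prime]
    (hX1 : ClassX1 W p) (hr0 : W.analyticRank = 0)
    (W₀ : WeierstrassCurve ℚ) [W₀.IsElliptic] [W₀.IsGloballyMinimal] (hiso : IsIsogenous W W₀)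
    {n k : ℕ} (hμ₀ : X1.MuPart.AnalyticMuLE W₀ p 0) (hlam : X1.ParitySqueeze.AnalyticLambdaEq W₀ p n)
    (halg : X1.TamagawaSqueeze.AlgebraicLambdaGE W₀ p k) (hnk : n ≤ k) :
    MazurMainConjecture W p := by
  have hmod' : hasEntireLFunction_rat :=
    WeierstrassCurve.hasEntireLFunction_rat_of_exists_isNewformOf hnf
  have hX1₀ : ClassX1 W₀ p := ClassX1.of_isIsogenous hiso hX1
  have hp2 : 2 < p := hX1₀.1
  have hred₀ : Red W₀ p := hX1₀.2.1
  have hgood₀ : Good W₀ p := hX1₀.2.2.1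
  have hp : p ≠ 2 := by omega
  obtain ⟨-, hord₀⟩ := goodOrd_of_red_of_good W₀ p hp2 hgood₀ hred₀
  have hμpart : X1.MuLambda.MuPartAt W₀ p :=
    X1.MuPart.muPartAt_of_analyticMuLE_zero hW16 hp hgood₀ hord₀ hred₀ hμ₀
  have hMC₀ : MazurMainConjecture W₀ p :=
    X1.TamagawaSqueeze.mazurMainConjecture_of_algebraicLambdaGE hW16 hp hgood₀ hord₀ hred₀ hμpart hlam
      halg hnk
  exact (Rank1ResidualX1Isogeny.mazurMainConjecture_iff_of_isIsogenous_of_analyticRank_eq_zero hW16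
    hGr hmod hmod' hGZK hCassels W W₀ hiso p hX1 hr0).mpr hMC₀

/-! ## §2. The door: the crux by name from `PublishedInputs`, Wuthrich Thm. 16 and the two open stubs -/

/-- **THE DOOR of line `mudescent` on crux 5.** The crux
`Summit.BirchSwinnertonDyer.BirchSwinnertonDyer.Theses.EisensteinPrimes.MazurMCOnX1RankZero` (Mazur's
cyclotomic main conjecture at EVERY rank-0 X1 pair) follows from the route's published inputs
`EisensteinPrimes.PublishedInputs` (support item stmt-BirchSwinnertonDyer-19037), Kato–Wuthrich
divisibility at a good ordinary reducible prime (`Wuthrich2014.charIdeal_dvd_padicLFunction`, PUB,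
cite-only — the skeleton's `stub_wuthrich16`), and the two open stubs of the superseded skeleton
`mudescent` (ky g7, d113fc0a38784230) taken as hypotheses VERBATIM: `hμ` = `stub_analyticMuZero_offLocus`
(`μ_an = 0` at every rank-0 X1 pair off the `μ`-barrier locus — Greenberg's μ-conjecture, anomalous
Eisenstein case, analytic face; OPEN) and `hlc` = `stub_lambdaCount_offLocus` (the Greenberg–Vatsal
λ-count extended to type A; OPEN). Proof = the registered composition `MazurMCOnX1RankZero_of`:
DESCEND by `stub_locate` (LANDED p443510), then `mazurMainConjecture_of_member_rankZero`.
[cite: GreenbergLNM1716, Conj. 1.11 (p. 58), Prop. 5.7, Cor. 5.6 (p. 136)]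
[cite: GreenbergVatsal2000, §3 Rem. after Cor. (3.8) and p. 5] [cite: Wuthrich2014, Thm. 16 (p. 397)] -/
theorem mazurMCOnX1RankZero_of_analyticMuZero_offLocus_of_lambdaCount_offLocus
    (hP : EisensteinPrimes.PublishedInputs) (hW16 : Wuthrich2014.charIdeal_dvd_padicLFunction)
    (hμ : ∀ (W₀ : WeierstrassCurve ℚ) [W₀.IsElliptic] [W₀.IsGloballyMinimal] (p : ℕ) [Fact p.Prime],
      ClassX1 W₀ p → W₀.analyticRank = 0 → ¬ HasRamifiedOddLineAt W₀ p →
        X1.MuPart.AnalyticMuLE W₀ p 0)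
    (hlc : ∀ (W₀ : WeierstrassCurve ℚ) [W₀.IsElliptic] [W₀.IsGloballyMinimal] (p : ℕ) [Fact p.Prime],
      ClassX1 W₀ p → W₀.analyticRank = 0 → ¬ HasRamifiedOddLineAt W₀ p →
        ∃ n k : ℕ, X1.ParitySqueeze.AnalyticLambdaEq W₀ p n ∧
          X1.TamagawaSqueeze.AlgebraicLambdaGE W₀ p k ∧ n ≤ k) :
    Summit.BirchSwinnertonDyer.BirchSwinnertonDyer.Theses.EisensteinPrimes.MazurMCOnX1RankZero := by
  unfold Summit.BirchSwinnertonDyer.BirchSwinnertonDyer.Theses.EisensteinPrimes.MazurMCOnX1RankZero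
  intro W _ _ p _ hX1 hr0
  have hCassels := hP.2.1
  have hGr := hP.2.2.2.1
  have hmod := hP.2.2.2.2.1
  have hnf := hP.2.2.2.2.2.1
  have hGZK := hP.2.2.2.2.2.2.2.2.2.2.1
  -- DESCEND
  obtain ⟨W₀, _, _, hiso, hoff⟩ := EisensteinPrimesMazurMCOnX1RankZeroLocate.stub_locate W p hX1 hr0
  have hX1₀ : ClassX1 W₀ p := ClassX1.of_isIsogenous hiso hX1
  have hr0₀ : W₀.analyticRank = 0 := by rw [← analyticRank_eq_of_isIsogenous' hiso]; exact hr0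
  -- μ and λ off the locus, route T at `W₀`, ASCEND
  obtain ⟨n, k, hlam, halg, hnk⟩ := hlc W₀ p hX1₀ hr0₀ hoff
  exact mazurMainConjecture_of_member_rankZero hW16 hGr hmod hnf hGZK hCassels W p hX1 hr0 W₀ hiso
    (hμ W₀ p hX1₀ hr0₀ hoff) hlam halg hnk

/-! ## §3. By-product: Greenberg's Conj. 1.11 on the rank-0 X1 leaf from stub 4 alone -/

/-- **Stub 4 forces `μ_alg = 0` off the locus (Greenberg's Conj. 1.11 on X1 ∩ {r = 0}, located form).**
Granted Wuthrich 2014 Thm. 16 (`hW16`) and a modular parametrisation (`hmod`), the open stub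
`stub_analyticMuZero_offLocus` (hypothesis `hμ`) implies: at every rank-0 X1 pair `(W₀, p)` with no
ramified-odd rational `p`-line, `μ(D.X) = 0` for every cyclotomic `κ`, topological generator `γ` (a
cyclotomic variable) and every Pontryagin-dual datum `D` of `Sel_{p^∞}(W₀/ℚ_∞)` — the Kato–Wuthrich
direction `μ_alg ≤ μ_an` (`X1.MuPart.mu_eq_zero_of_analyticMuLE_zero`).
[cite: GreenbergLNM1716, Conj. 1.11 (p. 58)] [cite: Wuthrich2014, Thm. 16 (p. 397)] -/
theorem mu_eq_zero_offLocus_of_analyticMuZero_offLocus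
    (hW16 : Wuthrich2014.charIdeal_dvd_padicLFunction) (hmod : nonempty_modularParametrizationData)
    (hμ : ∀ (W₀ : WeierstrassCurve ℚ) [W₀.IsElliptic] [W₀.IsGloballyMinimal] (p : ℕ) [Fact p.Prime],
      ClassX1 W₀ p → W₀.analyticRank = 0 → ¬ HasRamifiedOddLineAt W₀ p →
        X1.MuPart.AnalyticMuLE W₀ p 0)
    (W₀ : WeierstrassCurve ℚ) [W₀.IsElliptic] [W₀.IsGloballyMinimal] (p : ℕ) [Fact p.Prime]
    (hX1₀ : ClassX1 W₀ p) (hr0₀ : W₀.analyticRank = 0) (hoff : ¬ HasRamifiedOddLineAt W₀ p)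
    {κ : ZpExtension ℚ p} {γ : Field.absoluteGaloisGroup ℚ}
    (hκ : κ.IsCyclotomic) (hγ : κ.IsTopGenerator γ) (hγ' : IsCyclotomicVariable p γ)
    (D : W₀.SelmerDualData κ γ) : D.mu = 0 := by
  have hp2 : 2 < p := hX1₀.1
  have hp : p ≠ 2 := by omega
  obtain ⟨-, hord₀⟩ := goodOrd_of_red_of_good W₀ p hp2 hX1₀.2.2.1 hX1₀.2.1
  exact X1.MuPart.mu_eq_zero_of_analyticMuLE_zero hW16 hmod hp hX1₀.2.2.1 hord₀ hX1₀.2.1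
    (hμ W₀ p hX1₀ hr0₀ hoff) hκ hγ hγ' D

/-- **Greenberg's «some isogenous curve has `μ = 0`» on X1 ∩ {r = 0} from stub 4**: granted Wuthrich
Thm. 16 and modularity, `stub_analyticMuZero_offLocus` (hypothesis `hμ`, OPEN) implies that every
rank-0 X1 pair `(W, p)` is `ℚ`-isogenous to a globally minimal `W₀` — the étale end of `stub_locate`
(LANDED p443510) — whose cyclotomic dual data all have `μ = 0`.
[cite: GreenbergLNM1716, Conj. 1.11 and the paragraph after it (p. 58)] [cite: Wuthrich2014, Thm. 16 (p. 397)] -/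
theorem exists_isIsogenous_mu_eq_zero_of_analyticMuZero_offLocus
    (hW16 : Wuthrich2014.charIdeal_dvd_padicLFunction) (hmod : nonempty_modularParametrizationData)
    (hμ : ∀ (W₀ : WeierstrassCurve ℚ) [W₀.IsElliptic] [W₀.IsGloballyMinimal] (p : ℕ) [Fact p.Prime],
      ClassX1 W₀ p → W₀.analyticRank = 0 → ¬ HasRamifiedOddLineAt W₀ p →
        X1.MuPart.AnalyticMuLE W₀ p 0)
    (W : WeierstrassCurve ℚ) [W.IsElliptic] [W.IsGloballyMinimal] (p : ℕ) [Fact p.Prime]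
    (hX1 : ClassX1 W p) (hr0 : W.analyticRank = 0) :
    ∃ (W₀ : WeierstrassCurve ℚ) (_ : W₀.IsElliptic) (_ : W₀.IsGloballyMinimal),
      IsIsogenous W W₀ ∧ ∀ (κ : ZpExtension ℚ p) (γ : Field.absoluteGaloisGroup ℚ),
        κ.IsCyclotomic → κ.IsTopGenerator γ → IsCyclotomicVariable p γ →
        ∀ D : W₀.SelmerDualData κ γ, D.mu = 0 := by
  obtain ⟨W₀, _, _, hiso, hoff⟩ := EisensteinPrimesMazurMCOnX1RankZeroLocate.stub_locate W p hX1 hr0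
  have hX1₀ : ClassX1 W₀ p := ClassX1.of_isIsogenous hiso hX1
  have hr0₀ : W₀.analyticRank = 0 := by rw [← analyticRank_eq_of_isIsogenous' hiso]; exact hr0
  exact ⟨W₀, ‹_›, ‹_›, hiso, fun κ γ hκ hγ hγ' D ↦
    mu_eq_zero_offLocus_of_analyticMuZero_offLocus hW16 hmod hμ W₀ p hX1₀ hr0₀ hoff hκ hγ hγ' D⟩

end Summit.BirchSwinnertonDyer.BirchSwinnertonDyer.Theorems.EisensteinPrimesMazurMCOnX1RankZeroMudescent
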